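import Mathlib.Geometry.Manifold.Instances.Sphere
import Mathlib.Geometry.Manifold.Diffeomorph
import Literature.Topology.FourManifolds.Cobordism
import Literature.Topology.FourManifolds.HomotopySpheres
import Literature.Topology.FourManifolds.ThetaFour
import Literature.Topology.FourManifolds.SphereSimplyConnected
import Mathlib.AlgebraicTopology.FundamentalGroupoid.SimplyConnected
import HarnessLib

/-!
# Barrier (SmoothPoincare4): invariants of the smooth h-cobordism class — in particular unitary TQFTs — cannot detect a homotopy 4-sphere

Barrier catalogue `Literature/Barriers/SmoothPoincare4/` (D-0021), entry for the technique class
**"distinguish a homotopy 4-sphere `Σ` from `S⁴` by an invariant of closed smooth 4-manifolds that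
is constant on smooth h-cobordism classes"**, whose printed instance is the theorem of
Freedman–Kitaev–Nayak–Slingerland–Walker–Wang that unitary `(3+1)`-dimensional TQFTs cannot
distinguish smoothly h-cobordant (s-cobordant) 4-manifolds. (Compare the sibling entry
`HCobordismTheoremFails.lean`, which records that the h-cobordism THEOREM fails in dimension 4 — a
barrier on the positive side; the present entry is on the negative side: `Σ` IS h-cobordant to
`S⁴`, so nothing that factors through h-cobordism can see it.)

## What is printed

* Kervaire–Milnor 1963, Thm. 1.1 (`Θ₄ = 0` in the h-cobordism sense): every homotopy 4-sphere is
  smoothly h-cobordant to `S⁴`. Tree: `Literature.Topology.FourManifolds.isHCobordant_sphere_of_homotopySphere_four`.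
* FKNSWW 2005, abstract: "The results in dimension 4 imply that unitary TQFTs cannot distinguish
  homotopy equivalent simply connected 4-manifolds, nor can they distinguish smoothly s-cobordant
  4-manifolds"; Thm. 4.1: "UTQFTs cannot distinguish 1-connected smooth 4-manifolds which are
  homotopy equivalent. In fact, even a less rigid 'theory', where Atiyah's gluing axiom is only
  enforced along homology 3-spheres, will likewise be unable to distinguish homotopy equivalent
  4-manifolds."; Thm. 4.2: "UTQFTs cannot distinguish smoothly s-cobordant 4-manifolds."
  Mechanism (§4): an h-cobordism between 1-connected `P`, `Q` is a product off a contractible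
  sub-h-cobordism, `P = C ∪_S M`, `Q = C ∪_S M'` with `M ∪ M̄ ≅ M ∪ M̄' ≅ M' ∪ M̄' ≅ S⁴`, so the
  vector `x = M − M'` has `⟨x, x⟩ = S⁴ − S⁴ − S⁴ + S⁴ = 0` in the universal pairing and a unitary
  (positive) theory has `Z(M) = Z(M')`, hence `Z(P) = Z(Q)`.
* Reutter 2023, §1.3: "it is shown [in FKNSWW] that a unitary topological field theory cannot
  distinguish smoothly s-cobordant manifolds. Since any two s-cobordant manifolds are stably
  diffeomorphic ... and since any unitary topological field theory is semisimple ..., our result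
  may be viewed both as a strengthening and a generalization".

## How it is rendered here (relative to the tree's named facts, D-0014)

* `IsHCobordismInvariant I` — the technique class, explicit: functions `I` of simply connected
  closed smooth 4-manifolds with `I M = I N` whenever `Literature.IsHCobordant 4 M N` (a compact smooth
  5-dimensional h-cobordism; for simply connected ends h- and s-cobordism coincide, `Wh(1) = 0`).
* `HCobordismInvariantBarrierFour.{u}` — the barrier (universe-polymorphic in the value type): every
  such `I` has `I Σ = I S⁴` for every homotopy 4-sphere `Σ` (`Literature.HomotopySphere 4`); PROVED
  (`hCobordismInvariantBarrierFour_of_theta_four`) from `Θ₄ = 0` (tree fact, hypothesis) and the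
  tree's proved `π₁(S⁴) = 1` (`Literature.Topology.FourManifolds.simplyConnectedSpace_sphere_four_holds`).
TQFTs (symmetric monoidal functors on `Bord₄`) and the universal manifold pairing are not in Mathlib
or the tree; FKNSWW Thms. 4.1-4.2 enter as citations for membership in the class.

## References

[KervaireMilnorAnnals1963] [FKNSWW2005] [Reutter2023SemisimpleTFT] [WallJLMS1964] [Matveyev1996]
[CurtisFreedmanHsiangStong1996] [HatcherAT2002]
-/

noncomputable section

open scoped Manifold ContDiff
open ContinuousMap

namespace Literature.Barriers.SmoothPoincare4

universe u

/-- Local notation: `𝔼 n` is the model Euclidean space `EuclideanSpace ℝ (Fin n)`. -/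
local notation "𝔼 " n:arg => EuclideanSpace ℝ (Fin n)

/-- Local notation: `𝕊 n` is the unit sphere in `EuclideanSpace ℝ (Fin (n + 1))`, the standard
`n`-sphere with its Mathlib manifold structure. -/
local notation "𝕊 " n:arg => (Metric.sphere (0 : EuclideanSpace ℝ (Fin (n + 1))) 1)

/-! ### The technique class -/

/-- **Technique class: invariants of the smooth h-cobordism class** of closed smooth 4-manifolds.
`I` assigns a value in `α` to every 4-dimensional charted space (only SIMPLY CONNECTED closed
smooth 4-manifolds — Hausdorff, second countable, compact, simply connected, `C^∞` on `ℝ⁴`, in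
`Type` — matter) and `I M = I N` whenever `M` and `N` are simply connected, closed, smooth and
smoothly h-cobordant (`Literature.IsHCobordant 4 M N`: a compact smooth 5-manifold `W` with `∂W = M ⊔ N`,
both inclusions homotopy equivalences; for simply connected ends h- and s-cobordism coincide,
`Wh(1) = 0`). Simple connectivity is imposed because that is the printed scope: FKNSWW prove that
a unitary `(3+1)`-dimensional TQFT takes equal values on smoothly h-cobordant 1-connected
4-manifolds (proof of Thm. 4.1) and on smoothly s-cobordant 4-manifolds (Thm. 4.2) — for
non-simply-connected h-cobordant pairs nothing is printed. Further printed members: every invariant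
of the `S² × S²`-stable diffeomorphism type of simply connected manifolds (Wall 1964, Thm. 3:
h-cobordant ⇒ stably diffeomorphic; cf. the pending sibling entry `StableInvariantsBlind.lean`).
[cite: FKNSWW2005, Thm. 4.1 (proof) and Thm. 4.2] [cite: WallJLMS1964, Thm. 3] -/
def IsHCobordismInvariant {α : Type*}
    (I : ∀ (M : Type) [TopologicalSpace M] [ChartedSpace (𝔼 4) M], α) : Prop :=
  ∀ (M N : Type)
    [TopologicalSpace M] [T2Space M] [SecondCountableTopology M] [ChartedSpace (𝔼 4) M]
    [IsManifold (𝓡 4) ∞ M] [CompactSpace M] [SimplyConnectedSpace M]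
    [TopologicalSpace N] [T2Space N] [SecondCountableTopology N] [ChartedSpace (𝔼 4) N]
    [IsManifold (𝓡 4) ∞ N] [CompactSpace N] [SimplyConnectedSpace N],
    Literature.Topology.FourManifolds.IsHCobordant 4 M N → I M = I N

/-! ### The barrier -/

/-- **Barrier (named statement): no invariant of the smooth h-cobordism class distinguishes a
homotopy 4-sphere from `S⁴`.** For every `α`, every `I` with `IsHCobordismInvariant I` and every
homotopy 4-sphere `Σ` (`Literature.HomotopySphere 4`), `I Σ = I S⁴`; the value universe `u` of `α` is
a parameter (`HCobordismInvariantBarrierFour.{u}`), so that invariants valued in large types (Hilbert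
spaces as objects of a category, modules) are covered. PROVED below
(`hCobordismInvariantBarrierFour_of_theta_four`) from `Θ₄ = 0` as vendored in the tree (and the
tree's proof of `π₁(S⁴) = 1`); relative to Literature the barrier is a theorem — its content is in
the membership theorems cited.

BARRIER (D-0021), one line per key:
* technique_class: invariants of simply connected closed smooth 4-manifolds constant on smooth h-cobordism (= s-cobordism) classes (`IsHCobordismInvariant`); printed members: unitary `(3+1)`-dimensional TQFTs, and even "theories" with the gluing axiom enforced only along homology 3-spheres [cite: FKNSWW2005, Thm. 4.1 (proof: h-cobordant 1-connected `P`, `Q` have `Z(P) = Z(Q)`) and Thm. 4.2]; all `S² × S²`-stable diffeomorphism invariants [cite: WallJLMS1964, Thm. 3], among them all semisimple oriented 4d TFTs [cite: Reutter2023SemisimpleTFT, §1.1 Thm. 1 and §1.3].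
* blocks: refuting `SmoothPoincare4` (`Literature.SPC4.SmoothPoincareConjectureFour`; bundled form `∀ S : HomotopySphere 4, S ≅ S⁴`) by exhibiting such an invariant with `I Σ ≠ I S⁴` (`HCobordismInvariantBarrierFour`); "This may illuminate the difficulties that have been met by several authors in their attempts to formulate unitary TQFTs for `d = 3+1`" [cite: FKNSWW2005, abstract].
* because: every homotopy 4-sphere is smoothly h-cobordant to `S⁴` [cite: KervaireMilnorAnnals1963, Thm. 1.1] (tree `Literature.Topology.FourManifolds.isHCobordant_sphere_of_homotopySphere_four`), so an h-cobordism invariant takes equal values (`hCobordismInvariantBarrierFour_of_theta_four`); for a unitary `Z`: a 1-connected h-cobordism is a product outside a contractible piece, `P = C ∪_S M`, `Q = C ∪_S M'` with all three doubles `M ∪ M̄`, `M ∪ M̄'`, `M' ∪ M̄'` diffeomorphic to `S⁴` [cite: CurtisFreedmanHsiangStong1996, Theorem] [cite: Matveyev1996, Theorem], whence `⟨M − M', M − M'⟩ = 0` in the universal manifold pairing and positivity forces `Z(M) = Z(M')`, `Z(P) = Z(Q)` [cite: FKNSWW2005, §4, proof of Thm. 4.1].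
* evasions_known: none published within unitary/semisimple TQFT; FKNSWW note "The choice of smooth category might be essential" and that positivity of the 3-dimensional pairings is conjectural [cite: FKNSWW2005, §1 and Conjecture 2.2]; non-unitary, non-semisimple theories are outside both this entry and [cite: Reutter2023SemisimpleTFT, Thm. 1] (the latter covers all semisimple ones, unitary or not).
* scope_caveats: (a) FKNSWW's theorems are about UNITARY TQFTs (Hilbert-space valued, `Z(W̄) = Z(W)†`) in the Atiyah sense [cite: FKNSWW2005, §1]; (b) the formal class `IsHCobordismInvariant` is restricted to SIMPLY CONNECTED closed manifolds in `Type` (the printed scope; non-simply-connected h-cobordant pairs, where h- and s-cobordism differ, are deliberately excluded) and uses the tree's UNORIENTED `Literature.Topology.FourManifolds.IsHCobordant`, which for simply connected ends is equivalent to the oriented notion (an h-cobordism with simply connected ends is simply connected, hence orientable); (c) the barrier is void in dimensions `n ≥ 5`, where h-cobordant simply connected closed manifolds are diffeomorphic (Smale), so "h-cobordism invariant" is no restriction there — the entry is specific to `n = 4` through [cite: KervaireMilnorAnnals1963, Thm. 1.1] combined with the failure of the h-cobordism theorem (sibling entry `HCobordismTheoremFails.lean`).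
* status: established (theorem `hCobordismInvariantBarrierFour_of_theta_four` relative to the tree fact `Literature.Topology.FourManifolds.isHCobordant_sphere_of_homotopySphere_four`; membership of UTQFTs is [cite: FKNSWW2005, Thms. 4.1-4.2]) [cite: KervaireMilnorAnnals1963, Thm. 1.1]

[cite: FKNSWW2005, Thm. 4.1, Thm. 4.2 and abstract] [cite: KervaireMilnorAnnals1963, Thm. 1.1] -/
def HCobordismInvariantBarrierFour : Prop :=
  ∀ (α : Type u) (I : ∀ (M : Type) [TopologicalSpace M] [ChartedSpace (𝔼 4) M], α),
    IsHCobordismInvariant I → ∀ S : Literature.Topology.FourManifolds.HomotopySphere 4, I S.carrier = I (𝕊 4)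

/-- **The mechanism, for one invariant**: an h-cobordism invariant takes the value `I S⁴` on every
homotopy 4-sphere, GIVEN `Θ₄ = 0` (`Literature.Topology.FourManifolds.isHCobordant_sphere_of_homotopySphere_four`, Kervaire–Milnor
1963 Thm. 1.1, hypothesis `hΘ`); simple connectivity of `Σ` is transported along `Σ ≃ₕ S⁴` from
the tree's proved `Literature.Topology.FourManifolds.simplyConnectedSpace_sphere_four_holds` (`π₁(S⁴) = 1`, Hatcher Prop. 1.14).
[cite: KervaireMilnorAnnals1963, Thm. 1.1] [cite: FKNSWW2005, Thm. 4.1] [cite: HatcherAT2002, Prop. 1.14] -/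
theorem IsHCobordismInvariant.apply_homotopySphere_eq {α : Type*}
    {I : ∀ (M : Type) [TopologicalSpace M] [ChartedSpace (𝔼 4) M], α}
    (hI : IsHCobordismInvariant I) (hΘ : Literature.Topology.FourManifolds.isHCobordant_sphere_of_homotopySphere_four)
    (S : Literature.Topology.FourManifolds.HomotopySphere 4) : I S.carrier = I (𝕊 4) := by
  obtain ⟨e⟩ := S.nonempty_homotopyEquiv
  haveI : SimplyConnectedSpace (𝕊 4) := Literature.Topology.FourManifolds.simplyConnectedSpace_sphere_four_holds
  haveI : SimplyConnectedSpace S.carrier := e.simplyConnectedSpace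
  exact hI S.carrier (𝕊 4) (hΘ S)

/-- **`HCobordismInvariantBarrierFour` holds**, GIVEN `Θ₄ = 0` (D-0014: the named fact enters as a
hypothesis). [cite: KervaireMilnorAnnals1963, Thm. 1.1] [cite: FKNSWW2005, Thm. 4.2] -/
theorem hCobordismInvariantBarrierFour_of_theta_four
    (hΘ : Literature.Topology.FourManifolds.isHCobordant_sphere_of_homotopySphere_four) : HCobordismInvariantBarrierFour.{u} :=
  fun _ _ hI S => hI.apply_homotopySphere_eq hΘ S

/-- Every diffeomorphism-type statement is downstream: GIVEN `Θ₄ = 0`, an h-cobordism invariant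
which DID separate some homotopy 4-sphere from `S⁴` would yield a contradiction — the form in which
a route positing such an invariant (e.g. a unitary or semisimple TQFT value) is closed by this
entry. [cite: FKNSWW2005, Thm. 4.1] -/
theorem IsHCobordismInvariant.not_separates {α : Type*}
    {I : ∀ (M : Type) [TopologicalSpace M] [ChartedSpace (𝔼 4) M], α}
    (hI : IsHCobordismInvariant I) (hΘ : Literature.Topology.FourManifolds.isHCobordant_sphere_of_homotopySphere_four) :
    ¬ ∃ S : Literature.Topology.FourManifolds.HomotopySphere 4, I S.carrier ≠ I (𝕊 4) :=
  fun ⟨S, hS⟩ => hS (hI.apply_homotopySphere_eq hΘ S)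

end Literature.Barriers.SmoothPoincare4

end
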